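import Summits.RiemannHypothesis.RiemannHypothesis.Theses.RuelleBand

/-!
# RiemannHypothesis / RuelleBand — the support item `LadderGlue` (the band ladder is monotone)

Route `RiemannHypothesis/RuelleBand`, item stmt-RiemannHypothesis-2068 (`LadderGlue`, support,
rank 9):

  `(ExactFirstBand → CofiniteCriticalLine) ∧ (CofiniteCriticalLine → AsymptoticCriticalLine)`.

The three rungs of the route's ladder are

* `ExactFirstBand` (thesis X): every zero of `ζ` with `0 < Re s < 1` has `Re s = 1/2` or
  `Im s = 0`;
* `CofiniteCriticalLine`: the set of zeros of `ζ` in the open strip off the critical line is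
  finite;
* `AsymptoticCriticalLine`: for every `ε > 0` the set of zeros of `ζ` in the open strip with
  `ε ≤ |Re s − 1/2|` is finite.

Both implications are elementary:

1. Under X an off-line zero `s` of the open strip is real (`Im s = 0`), and `ζ` has no real zeros
   in `(0,1)` (`ζ(σ) < 0` there, Titchmarsh §2.12; in the tree as
   `Literature.NumberTheory.LFunctions.riemannZeta_ne_zero_of_im_eq_zero_of_pos_of_lt_one`,
   file `Literature/NumberTheory/LFunctions/ZetaRealAxis.lean`, proved, already imported by the
   route file). Hence the off-line set is empty, in particular finite.
2. For `ε > 0`, `ε ≤ |Re s − 1/2|` forces `Re s ≠ 1/2`, so each `ε`-band set is a subset of the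
   off-line set (`Set.Finite.subset`).

No named facts are used; the cone is that of the route file (Mathlib + `ZetaRealAxis`).
-/

-- D-0017: a single-problem summit has `RiemannHypothesis.RiemannHypothesis` in every name by
-- design; the lakefile turns this linter off for `Summits`; repeated here so that standalone
-- elaboration is warning-free as well.
set_option linter.dupNamespace false

namespace Summit.RiemannHypothesis.RiemannHypothesis.Theorems

open Summit.RiemannHypothesis.RiemannHypothesis.Theses.RuelleBand

/-- First half of `LadderGlue`: thesis X (`ExactFirstBand`) implies `CofiniteCriticalLine`.
Under X a zero of `ζ` in the open critical strip off the line `Re s = 1/2` would be real, and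
`ζ(σ) ≠ 0` for `0 < σ < 1` (Titchmarsh §2.12, tree lemma
`riemannZeta_ne_zero_of_im_eq_zero_of_pos_of_lt_one`); so the off-line set is empty. [folklore] -/
theorem ruelleBand_cofiniteCriticalLine_of_exactFirstBand (hX : ExactFirstBand) :
    CofiniteCriticalLine := by
  unfold CofiniteCriticalLine
  refine Set.finite_empty.subset ?_
  rintro s ⟨hz, h0, h1, hne⟩
  rcases hX s hz h0 h1 with h | him
  · exact hne h
  · exact Literature.NumberTheory.LFunctions.riemannZeta_ne_zero_of_im_eq_zero_of_pos_of_lt_one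
      him h0 h1 hz

/-- Second half of `LadderGlue`: `CofiniteCriticalLine` implies `AsymptoticCriticalLine`.
For `ε > 0` the condition `ε ≤ |Re s − 1/2|` forces `Re s ≠ 1/2`, so every `ε`-band set of zeros
is contained in the (finite) off-line set. [folklore] -/
theorem ruelleBand_asymptoticCriticalLine_of_cofiniteCriticalLine (hC : CofiniteCriticalLine) :
    AsymptoticCriticalLine := by
  unfold AsymptoticCriticalLine
  intro ε hε
  refine hC.subset ?_
  rintro s ⟨hz, h0, h1, hband⟩
  refine ⟨hz, h0, h1, fun h => ?_⟩
  rw [h, sub_self, abs_zero] at hband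
  exact absurd hband (not_le.mpr hε)

/-- **The band ladder is monotone** (support item stmt-RiemannHypothesis-2068, `LadderGlue`, of
route `RuelleBand`): `(ExactFirstBand → CofiniteCriticalLine) ∧ (CofiniteCriticalLine →
AsymptoticCriticalLine)`. The type is literally the route decl `LadderGlue`. [folklore] -/
theorem ruelleBand_ladderGlue_proof : LadderGlue := by
  unfold LadderGlue
  exact ⟨ruelleBand_cofiniteCriticalLine_of_exactFirstBand,
    ruelleBand_asymptoticCriticalLine_of_cofiniteCriticalLine⟩

end Summit.RiemannHypothesis.RiemannHypothesis.Theorems
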